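import Literature.AlgebraicGeometry.HodgeTheory.DegreeOneHypersurfaceHodgeConjecture
import HarnessLib

/-!
# A split quadric minus a maximal linear subspace retracts onto the complementary one (topology)

Family `hodge`, layer `Literature/AlgebraicGeometry/HodgeTheory`. THEOREMS ONLY (no definition, no named
fact). Topological core of the Hodge conjecture for smooth QUADRICS
(`QuadricHypersurfaceHodgeConjecture`), in the sub-namespace `…HodgeTheory.SplitQuadric`.

For a continuous linear surjection `T : E → F` with continuous section `S` and a "quadratic" function
`q : E → ℂ` compatible with the straight-line deformation `blend t v = S(Tv) + t (v − S(Tv))` of the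
tree's `linHomotopy` (`HodgeTheory/HypersurfaceLefschetzProofs`) in the sense `q(blend t v) = t · q(v)` —
the situation of a split quadric `q(x, y) = Σ xᵢ yᵢ`, `T = y`, `S(w) = (0, w)` — the open subset
`U = {[v] | q(v) = 0, T v ≠ 0}` of the projective quadric `{q = 0} ⊆ ℙ(E)` retracts by deformation onto
the linear subspace `[S(F)] ≅ ℙ(F)` (a homotopy built from `linHomotopy`), so that `ℙ(F) → U`,
`[w] ↦ [S w]` is injective on singular cohomology (`exists_injective_map_quadricCompl`): `U` has no more
cohomology than `ℙ(F)`. Dually, restriction from `ℙᴺ(ℂ)` to a linear subspace is injective on `Hᵏ` as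
soon as the complement — which retracts onto a complementary linear subspace — has no `H_j`,
`k + j = 2N` (`injective_map_of_eq_projPoint_linSect`, Čech–Alexander–Lefschetz duality on `ℙᴺ(ℂ)`).

No definition (the projection, the section and the homotopy are built inside the proof of
`exists_injective_map_quadricCompl`).

Provenance: Literature home of the Summits-side
`Theorems/LimitExtensionHypersurfaceHodgeFourLowDegreeQuadricTopology` (route `LimitExtension`, item
`HypersurfaceHodgeFourLowDegree`, stmt-HodgeConjecture-3003), which `Literature/` may not import. Lane
`lit-hodgefound`, seat p20.

## References

* [HatcherAT2002] A. Hatcher, Algebraic Topology (CUP 2002), §3.1 (homotopy invariance), Thm. 2.10,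
  §3.3 Thm. 3.26 (c), Thm. 3.44, Prop. 3.46.
* [GriffithsHarrisPrinciples1978] P. Griffiths, J. Harris, Principles of Algebraic Geometry,
  Ch. 6 §1 (linear spaces on quadrics; the two rulings of an even-dimensional quadric).
* [SerreGAGA1956] J.-P. Serre, GAGA, Ann. Inst. Fourier 6 (1956), §2 n°5 Prop. 2.
* [Spanier1981] E. Spanier, Algebraic Topology, Ch. 6 §1 Thm. 10.
-/

noncomputable section

open scoped LinearAlgebra.Projectivization
open CategoryTheory CategoryTheory.Limits Topology
open Literature.AlgebraicTopology.SingularHomology Literature.AlgebraicTopology.Homotopy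
open Literature.AlgebraicGeometry.HodgeTheory Literature.AlgebraicGeometry.Motives
open Literature.NumberTheory.Transcendental (projPoint isHomeomorph_projPoint projPoint_injective)

namespace Literature.AlgebraicGeometry.HodgeTheory.SplitQuadric

section QuadCompl

variable {E F : Type} [AddCommGroup E] [Module ℂ E] [AddCommGroup F] [Module ℂ F]

/-- For `q` homogeneous of degree `2`, `[v]` lies in the projective quadric-type set
`{p | q(p.rep) = 0}` iff `q(v) = 0`. [cite: GriffithsHarrisPrinciples1978, Ch. 6 §1] -/
theorem mk_mem_setOf_rep_iff {q : E → ℂ} (hq2 : ∀ (c : ℂ) (v : E), q (c • v) = c ^ 2 * q v)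
    {v : E} (hv : v ≠ 0) : Projectivization.mk ℂ v hv ∈ {p : ℙ ℂ E | q p.rep = 0} ↔ q v = 0 := by
  obtain ⟨a, ha⟩ := Projectivization.exists_smul_eq_mk_rep ℂ v hv
  simp only [Set.mem_setOf_eq, ← ha, Units.smul_def, hq2, mul_eq_zero,
    or_iff_right (pow_ne_zero _ a.ne_zero)]

variable [TopologicalSpace E] [TopologicalSpace F] (T : E →L[ℂ] F) (S : F →L[ℂ] E) (q : E → ℂ)

variable {T S q} in
/-- If `q(blend t v) = t · q(v)` and `S` is a section of `T`, then `q` vanishes on `S(F)`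
(`t = 0`: `q(S(T(S w))) = q(S w) = 0 · q(S w)`). [cite: GriffithsHarrisPrinciples1978, Ch. 6 §1] -/
theorem apply_section_eq_zero (hTS : ∀ w, T (S w) = w)
    (hqb : ∀ (t : ℝ) (v : E), q (blend (T : E →ₗ[ℂ] F) (S : F →ₗ[ℂ] E) t v) = (t : ℂ) * q v)
    (w : F) : q (S w) = 0 := by
  have h := hqb 0 (S w)
  rw [blend_zero] at h
  change q (S (T (S w))) = _ at h
  rw [hTS] at h
  simpa using h

variable {T S q} in
/-- The deformation `linHomotopy` keeps the quadric-type set `{q = 0}` when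
`q(blend t v) = t · q(v)`. [cite: HatcherAT2002, §3.1] [cite: GriffithsHarrisPrinciples1978, Ch. 6 §1] -/
theorem coe_linHomotopy_mem_setOf_rep [IsTopologicalAddGroup E] [ContinuousSMul ℂ E]
    (hTS : ∀ w, T (S w) = w) (hq2 : ∀ (c : ℂ) (v : E), q (c • v) = c ^ 2 * q v)
    (hqb : ∀ (t : ℝ) (v : E), q (blend (T : E →ₗ[ℂ] F) (S : F →ₗ[ℂ] E) t v) = (t : ℂ) * q v)
    (t : unitInterval) (p : linComplSet (T : E →ₗ[ℂ] F)) (hp : q p.1.rep = 0) :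
    (linHomotopy T S hTS (t, p)).1 ∈ {p : ℙ ℂ E | q p.rep = 0} := by
  show Projectivization.mk ℂ (blend (T : E →ₗ[ℂ] F) (S : F →ₗ[ℂ] E) t p.1.rep)
    (blend_ne_zero _ _ hTS t p.2) ∈ {p : ℙ ℂ E | q p.rep = 0}
  rw [mk_mem_setOf_rep_iff hq2, hqb, hp, mul_zero]

/-- **The open piece `U = {[v] | q(v) = 0, T v ≠ 0}` of a projective quadric has no more cohomology
than the linear subspace `[S(F)] ≅ ℙ(F)`.** For a continuous linear `T : E → F` with continuous
section `S` and `q : E → ℂ` homogeneous of degree `2` with `q(blend t v) = t · q(v)` along the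
straight-line deformation `blend t v = S(Tv) + t(v − S(Tv))` (a split quadric `Σ xᵢyᵢ` with `T = y`,
`S w = (0, w)`): there is a continuous `e : ℙ(F) → U` over `[w] ↦ [S w]` (the corestriction of
`linSect`) which is injective on singular cohomology in every degree — because `linHomotopy`
PRESERVES the quadric, giving a deformation retraction of `U` onto `e(ℙ(F))`, and homotopy
invariance (`singularCohomology.map_eq_of_homotopic'`).
[cite: HatcherAT2002, §3.1 (homotopy invariance)] [cite: GriffithsHarrisPrinciples1978, Ch. 6 §1] -/
theorem exists_injective_map_quadricCompl [IsTopologicalAddGroup E] [ContinuousSMul ℂ E]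
    (hTS : ∀ w, T (S w) = w) (hq2 : ∀ (c : ℂ) (v : E), q (c • v) = c ^ 2 * q v)
    (hqb : ∀ (t : ℝ) (v : E), q (blend (T : E →ₗ[ℂ] F) (S : F →ₗ[ℂ] E) t v) = (t : ℂ) * q v) :
    ∃ e : C(ℙ ℂ F, ↥({p : ℙ ℂ E | q p.rep = 0} ∩ linComplSet (T : E →ₗ[ℂ] F))),
      (∀ w, (e w).1 = (linSect T S hTS w).1) ∧
        ∀ (R : Type) [CommRing R] (j : ℕ), Function.Injective (singularCohomology.map R R e j) := by
  -- the projection `U → ℙ(F)` and the section `ℙ(F) → U`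
  let π : C(↥({p : ℙ ℂ E | q p.rep = 0} ∩ linComplSet (T : E →ₗ[ℂ] F)), ℙ ℂ F) :=
    (linProj T).comp ⟨fun u ↦ ⟨u.1, u.2.2⟩, continuous_subtype_val.subtype_mk _⟩
  let e : C(ℙ ℂ F, ↥({p : ℙ ℂ E | q p.rep = 0} ∩ linComplSet (T : E →ₗ[ℂ] F))) :=
    ⟨fun w ↦ ⟨(linSect T S hTS w).1,
        (mk_mem_setOf_rep_iff hq2 _).2 (apply_section_eq_zero hTS hqb w.rep), (linSect T S hTS w).2⟩,
      (continuous_subtype_val.comp (linSect T S hTS).continuous).subtype_mk _⟩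
  -- the deformation retraction of `U` onto `e(ℙ(F))`
  have H : ContinuousMap.Homotopy (e.comp π) (ContinuousMap.id _) :=
    { toFun := fun x ↦ ⟨(linHomotopy T S hTS (x.1, ⟨x.2.1, x.2.2.2⟩)).1,
        coe_linHomotopy_mem_setOf_rep hTS hq2 hqb x.1 ⟨x.2.1, x.2.2.2⟩ x.2.2.1,
        (linHomotopy T S hTS (x.1, ⟨x.2.1, x.2.2.2⟩)).2⟩
      continuous_toFun :=
        (continuous_subtype_val.comp ((linHomotopy T S hTS).continuous.comp
          (continuous_fst.prodMk ((continuous_subtype_val.comp continuous_snd).subtype_mk _)))).subtype_mk _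
      map_zero_left := fun u ↦ by
        refine Subtype.ext ?_
        show ((linHomotopy T S hTS).toFun (0, ⟨u.1, u.2.2⟩)).1 =
          (((linSect T S hTS).comp (linProj T)) ⟨u.1, u.2.2⟩).1
        exact congrArg Subtype.val ((linHomotopy T S hTS).map_zero_left ⟨u.1, u.2.2⟩)
      map_one_left := fun u ↦ by
        refine Subtype.ext ?_
        show ((linHomotopy T S hTS).toFun (1, ⟨u.1, u.2.2⟩)).1 =
          ((ContinuousMap.id (linComplSet (T : E →ₗ[ℂ] F))) ⟨u.1, u.2.2⟩).1
        exact congrArg Subtype.val ((linHomotopy T S hTS).map_one_left ⟨u.1, u.2.2⟩) }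
  refine ⟨e, fun w ↦ rfl, fun R _ j a b h ↦ ?_⟩
  have key : ∀ z, z = singularCohomology.map R R π j (singularCohomology.map R R e j z) := fun z ↦ by
    rw [← ModuleCat.comp_apply, ← singularCohomology.map_comp,
      singularCohomology.map_eq_of_homotopic' R R ⟨H⟩ j, singularCohomology.map_id]
    rfl
  rw [key a, key b, h]

end QuadCompl

/-! ### Restriction to a linear subspace of `ℙᴺ(ℂ)` is injective when the complement is small -/

section LinearSubspaceRestriction

variable {N m m₂ : ℕ} (T : (Fin (N + 1) → ℂ) →L[ℂ] (Fin (m + 1) → ℂ))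
  (S : (Fin (m + 1) → ℂ) →L[ℂ] (Fin (N + 1) → ℂ))

/-- `[w] ↦ [S w]` is injective for `S` a section of `T` (apply `T`). [cite: GriffithsHarrisPrinciples1978, Ch. 6 §1] -/
theorem linSect_injective (hTS : ∀ w, T (S w) = w) : Function.Injective (linSect T S hTS) := by
  intro w w' h
  have h1 : (linSect T S hTS w).1 = (linSect T S hTS w').1 := congrArg Subtype.val h
  change Projectivization.mk ℂ (S w.rep) _ = Projectivization.mk ℂ (S w'.rep) _ at h1
  rw [Projectivization.mk_eq_mk_iff] at h1
  obtain ⟨a, ha⟩ := h1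
  rw [← Projectivization.mk_rep w, ← Projectivization.mk_rep w', Projectivization.mk_eq_mk_iff]
  refine ⟨a, ?_⟩
  have h2 := congrArg T ha
  rw [Units.smul_def, map_smul, hTS, hTS] at h2
  rw [Units.smul_def]
  exact h2

/-- The map `ℙ(ℂᵐ⁺¹) → ℙᴺ(ℂ)`, `[w] ↦ projPoint [S w]` onto the linear subspace `[S(ℂᵐ⁺¹)]`, is a
closed embedding (injective and continuous on a compact space; `projPoint : ℙ(ℂᴺ⁺¹) ≃ ℙᴺ_ℂ(ℂ)` is
Serre's comparison). [cite: SerreGAGA1956, §2 n°5 Prop. 2] -/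
theorem isClosedEmbedding_of_eq_projPoint_linSect (hTS : ∀ w, T (S w) = w)
    (e : C(ℙ ℂ (Fin (m + 1) → ℂ), ComplexPoints (projectiveSpace N ℂ)))
    (he : ∀ w, e w = projPoint N (linSect T S hTS w).1) : IsClosedEmbedding e := by
  haveI : CompactSpace (ℙ ℂ (Fin (m + 1) → ℂ)) := Projectivization.compactSpace_of_properSpace
  haveI := ComplexPoints.t2Space_of_isSmoothProjective (isSmoothProjective_projectiveSpace_holds ℂ N)
  have hfun : (e : ℙ ℂ (Fin (m + 1) → ℂ) → ComplexPoints (projectiveSpace N ℂ)) =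
      fun w ↦ projPoint N (linSect T S hTS w).1 := funext he
  refine e.continuous.isClosedEmbedding ?_
  rw [hfun]
  exact (projPoint_injective N).comp (Subtype.val_injective.comp (linSect_injective T S hTS))

variable (T₂ : (Fin (N + 1) → ℂ) →L[ℂ] (Fin (m₂ + 1) → ℂ)) (S₂ : (Fin (m₂ + 1) → ℂ) →L[ℂ] (Fin (N + 1) → ℂ))

/-- **The image of `[w] ↦ projPoint [S w]` is the linear subspace `{T₂ = 0}`**, for a second linear
map `T₂` cutting out `S(ℂᵐ⁺¹) = {v | T₂ v = 0} = {v | S(T v) = v}`. [cite: GriffithsHarrisPrinciples1978, Ch. 6 §1] -/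
theorem projPoint_mem_range_iff_of_eq_projPoint_linSect (hTS : ∀ w, T (S w) = w)
    (hcompat : ∀ v, T₂ v = 0 ↔ S (T v) = v)
    (e : C(ℙ ℂ (Fin (m + 1) → ℂ), ComplexPoints (projectiveSpace N ℂ)))
    (he : ∀ w, e w = projPoint N (linSect T S hTS w).1) (p : ℙ ℂ (Fin (N + 1) → ℂ)) :
    projPoint N p ∈ Set.range e ↔ T₂ p.rep = 0 := by
  constructor
  · rintro ⟨w, hw⟩
    rw [he] at hw
    have hp : (linSect T S hTS w).1 = p := projPoint_injective N hw
    obtain ⟨a, ha⟩ := Projectivization.exists_smul_eq_mk_rep ℂ (S w.rep)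
      (apply_ne_zero_of_section (T : (Fin (N + 1) → ℂ) →ₗ[ℂ] (Fin (m + 1) → ℂ))
        (S : (Fin (m + 1) → ℂ) →ₗ[ℂ] (Fin (N + 1) → ℂ)) hTS w.rep_nonzero)
    have hrep : p.rep = a • S w.rep := by rw [ha]; exact congrArg Projectivization.rep hp.symm
    have h0 : T₂ (S w.rep) = 0 := (hcompat _).2 (by rw [hTS])
    rw [hrep, Units.smul_def, map_smul, h0, smul_zero]
  · intro h0
    have hv : S (T p.rep) = p.rep := (hcompat _).1 h0
    have hT : T p.rep ≠ 0 := fun h ↦ p.rep_nonzero (by rw [← hv, h, map_zero])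
    refine ⟨Projectivization.mk ℂ (T p.rep) hT, ?_⟩
    rw [he]
    congr 1
    change Projectivization.mk ℂ (S (Projectivization.mk ℂ (T p.rep) hT).rep) _ = p
    conv_rhs => rw [← Projectivization.mk_rep p]
    rw [Projectivization.mk_eq_mk_iff]
    obtain ⟨b, hb⟩ := Projectivization.exists_smul_eq_mk_rep ℂ (T p.rep) hT
    refine ⟨b, ?_⟩
    rw [← hb, Units.smul_def, Units.smul_def, map_smul, hv]

/-- `H_j(ℙ(ℂᵐ⁺¹); ℂ) = 0` for `j > 2m` (closed `2m`-manifold `ℙᵐ_ℂ(ℂ) ≃ ℙ(ℂᵐ⁺¹)`, Hatcher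
Thm. 3.26 (c)). [cite: HatcherAT2002, §3.3 Thm. 3.26 (c)] -/
theorem isZero_singularHomology_projectivization_of_lt {j : ℕ} (hj : 2 * m₂ < j) :
    IsZero (singularHomology ℂ ℂ (ℙ ℂ (Fin (m₂ + 1) → ℂ)) j) :=
  (ComplexPoints.isZero_singularHomology_of_lt (isSmoothProjective_projectiveSpace_holds ℂ m₂) ℂ ℂ
    hj).of_iso (singularHomology.mapIso ℂ ℂ ((isHomeomorph_projPoint m₂).homeomorph (projPoint m₂)) j)

/-- **Restriction to the linear subspace `[S(ℂᵐ⁺¹)] ⊆ ℙᴺ(ℂ)` is injective on `Hᵏ` when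
`k + j = 2N`, `j > 2m₂`**, `{T₂ = 0} = [S(ℂᵐ⁺¹)]` with `T₂ : ℂᴺ⁺¹ → ℂ^{m₂+1}` a surjection with
section `S₂`: the complement `{T₂ ≠ 0}` retracts by deformation (`linHomotopy T₂ S₂`) onto
`ℙ(ℂ^{m₂+1})`, which has no homology in degree `j > 2m₂`, and Čech–Alexander–Lefschetz duality on
the closed oriented manifold `ℙᴺ(ℂ)` (`singularCohomology.map_subtypeVal_injective_of_isZero_compl`,
the subspace being compact and locally contractible, hence taut) gives injectivity of the
restriction. [cite: HatcherAT2002, §3.3 Thm. 3.44 and Prop. 3.46] [cite: Spanier1981, Ch. 6 §1 Thm. 10] -/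
theorem injective_map_of_eq_projPoint_linSect (hTS : ∀ w, T (S w) = w) (hTS₂ : ∀ w, T₂ (S₂ w) = w)
    (hcompat : ∀ v, T₂ v = 0 ↔ S (T v) = v)
    (e : C(ℙ ℂ (Fin (m + 1) → ℂ), ComplexPoints (projectiveSpace N ℂ)))
    (he : ∀ w, e w = projPoint N (linSect T S hTS w).1) {k j : ℕ} (hkj : k + j = 2 * N)
    (hj : 2 * m₂ < j) : Function.Injective (singularCohomology.map ℂ ℂ e k) := by
  classical
  -- the closed oriented `2N`-manifold `ℙᴺ(ℂ)`
  have hP : IsSmoothProjective N (projectiveSpace N ℂ) := isSmoothProjective_projectiveSpace_holds ℂ N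
  letI := hP.chartedSpace
  haveI := ComplexPoints.compactSpace_of_isSmoothProjective hP
  haveI := ComplexPoints.t2Space_of_isSmoothProjective hP
  let μ : HomologicalOrientation ℂ (ComplexPoints (projectiveSpace N ℂ)) (2 * N) :=
    (ComplexPoints.homologicalOrientationIntProjectiveSpace N).toCoeff ℂ
  -- the compact image `K` of `ℙ(ℂᵐ⁺¹)`
  haveI : CompactSpace (ℙ ℂ (Fin (m + 1) → ℂ)) := Projectivization.compactSpace_of_properSpace
  have hemb := (isClosedEmbedding_of_eq_projPoint_linSect T S hTS e he).isEmbedding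
  set K : Set (ComplexPoints (projectiveSpace N ℂ)) := Set.range e with hKdef
  have hKc : IsCompact K := isCompact_range hemb.continuous
  -- `K` is taut in `ℙᴺ(ℂ)`
  obtain ⟨n₀, f, hf⟩ := Literature.Geometry.Manifold.exists_isClosedEmbedding_pi_of_compactSpace
    (M := ComplexPoints (projectiveSpace N ℂ)) (EuclideanSpace ℝ (Fin (2 * N)))
  have hNR : IsNeighbourhoodRetract (Set.range f) :=
    isNeighbourhoodRetract_range_of_compactSpace
      isNeighbourhoodRetract_of_locallyContractibleSpace_holds (EuclideanSpace ℝ (Fin (2 * N)))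
      hf.isEmbedding
  have hKl : LocallyContractibleSpace K := by
    have hPm : IsSmoothProjective m (projectiveSpace m ℂ) := isSmoothProjective_projectiveSpace_holds ℂ m
    letI := hPm.chartedSpace
    have h1 : LocallyContractibleSpace (ℙ ℂ (Fin (m + 1) → ℂ)) :=
      locallyContractibleSpace_of_homeomorph
        ((isHomeomorph_projPoint m).homeomorph (projPoint m)).symm
        (locallyContractibleSpace_of_chartedSpace (EuclideanSpace ℝ (Fin (2 * m)))
          (M := ComplexPoints (projectiveSpace m ℂ)))
    exact locallyContractibleSpace_of_homeomorph hemb.toHomeomorph h1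
  obtain ⟨R⟩ := Cech.RetractionNhds.nonempty_of_locallyContractibleSpace hf.isEmbedding hNR hKc hKl
  -- the complement has no homology in degree `j`
  -- `↥Kᶜ ≃ₜ {[v] | T₂ v ≠ 0}` through `projPoint`
  have Θ : linComplSet (T₂ : (Fin (N + 1) → ℂ) →ₗ[ℂ] (Fin (m₂ + 1) → ℂ)) ≃ₜ ↥Kᶜ :=
    ((isHomeomorph_projPoint N).homeomorph (projPoint N)).subtype fun p ↦ by
      rw [Set.mem_compl_iff]
      change T₂ p.rep ≠ 0 ↔ projPoint N p ∉ Set.range e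
      rw [projPoint_mem_range_iff_of_eq_projPoint_linSect T S T₂ hTS hcompat e he]
  have hz : IsZero (singularHomology ℂ ℂ (↥Kᶜ) j) :=
    (isZero_singularHomology_linComplSet T₂ S₂ hTS₂
      (isZero_singularHomology_projectivization_of_lt hj)).of_iso
      (singularHomology.mapIso ℂ ℂ Θ.symm j)
  -- duality: `Hᵏ(ℙᴺ(ℂ)) → Hᵏ(↥K)` is injective
  have hinj := singularCohomology.map_subtypeVal_injective_of_isZero_compl μ hKc.isClosed R
    (p := k) (q := j) hkj hz
  -- factor `e = (↥K ↪ ℙᴺ(ℂ)) ∘ (ℙ(ℂᵐ⁺¹) ≃ K)`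
  have hfac : e =
      (⟨Subtype.val, continuous_subtype_val⟩ : C(↥K, ComplexPoints (projectiveSpace N ℂ))).comp
        (hemb.toHomeomorph : C(ℙ ℂ (Fin (m + 1) → ℂ), ↥K)) := by ext w; rfl
  rw [hfac, singularCohomology.map_comp]
  exact (singularCohomology_map_bijective_of_homeomorph hemb.toHomeomorph k).1.comp hinj

end LinearSubspaceRestriction

end Literature.AlgebraicGeometry.HodgeTheory.SplitQuadric

end
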